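import Literature.NumberTheory.GaloisRepresentations.CliffordInducedPrimeIndexAbstract
import Literature.NumberTheory.GaloisRepresentations.FramedGaloisRepInduce
import Literature.NumberTheory.GaloisRepresentations.CliffordTwistDichotomy
import Literature.NumberTheory.GaloisRepresentations.TwistedSumAssembly
import Literature.RepresentationTheory.Semisimple.SubrepresentationEquiv
import Literature.RepresentationTheory.Semisimple.CliffordCyclicTwist
import HarnessLib

/-!
# Clifford's theorem in prime index: an irreducible representation with reducible restriction
# to a normal subgroup of prime index is induced (characteristic polynomials)

Topic `NumberTheory/GaloisRepresentations`; namespace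
`Literature.NumberTheory.GaloisRepresentations`.  Theorems only: **no definition and no named
fact is introduced**.

Let `r : G →ₜ* GL_n(A)` be an IRREDUCIBLE framed continuous representation over an algebraically
closed topological field `A` and `φ : H →ₜ* G` an injective continuous homomorphism whose image
`N` has PRIME index `p`.

* `FramedRep.exists_charpoly_eq_charpoly_comp_indMatrix_of_conj_eq_twist` — **twist form ⟹
  induced form.**  If `P r P⁻¹ = r ⊗ χ` for a continuous character `χ ≠ 1` of `G` trivial on `N`
  (`FramedRep.conj`, `FramedRep.twist`), then `n = p · m` and there is an IRREDUCIBLE framed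
  `s : H →ₜ* GL_m(A)` with `det(X - r(x)) = det(X - Ind(s)(x))` for all `x ∈ G` and every
  transversal of `G / N` (`indMatrix`, `Matrix.comp`).  Proof: `P(r(g)v) = χ(g) r(g)(Pv)`, so
  `r(g)` maps the `λ`-eigenspace `V_λ` of `P` into `V_{χ(g)λ}`; `N ≤ ker χ` has index `p`, so for
  `g₀` with `ζ = χ(g₀) ≠ 1` one gets `ζ^p = 1`, `ζ` of exact order `p`, and `t₀ = (g₀^i)_{i<p}` a
  transversal of `G / N`; for an eigenvalue `λ₀ ≠ 0` of `P` (`Module.End.exists_eigenvalue`) the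
  `N`-stable `U = V_{λ₀}` has translates `r(g₀^i) U ≤ V_{ζ^i λ₀}` inside DISTINCT eigenspaces
  (`Module.End.eigenspaces_iSupIndep`), and `∑ᵢ r(g₀^i) U` is `G`-stable and non-zero
  (`Representation.map_iSup_map_le_of_transversal`), so `V = ⊕_{i<p} r(g₀^i) U`
  (`DirectSum.IsInternal.collectedBasis`); in the adapted basis the matrix of `r(x)` is `Ind(s)(x)`
  for `s` the frame of `U` (`Representation.toMatrix_eq_comp_indMatrix`, `ContinuousRep.frame`),
  `s` is irreducible (`Representation.isIrreducible_toRepresentation_of_iSupIndep`), and the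
  characteristic polynomial does not depend on the transversal
  (`charpoly_comp_indMatrix_eq_of_transversal`).
* `FramedRep.exists_charpoly_eq_charpoly_comp_indMatrix_of_prime` — **Clifford, prime index.**
  For `φ` an open embedding with normal image of prime index, `A` moreover of characteristic
  zero and `r ∘ φ` REDUCIBLE, the same conclusion: the quotient `G / N` is cyclic of order `p`, so
  `r` is a non-trivial twist of itself (`FramedRep.exists_twist_conj_of_not_isIrreducible_comp`,
  file `CliffordTwistDichotomy`).
* `exists_charpoly_eq_charpoly_induce_of_not_isIrreducible_restrictField_of_prime` — **Galois
  form.**  For a Galois extension of number fields `L/K` of prime degree and an irreducible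
  `r : Γ_K → GL_n(A)` with `r|_{Γ_L}` reducible: `n = [L:K] · m` and
  `det(X - r(σ)) = det(X - Ind_{Γ_L}^{Γ_K}(s)(σ))` for an irreducible `s : Γ_L → GL_m(A)`
  (`FramedGaloisRep.induce`) — the step "`ρ|_{Γ_L}` reducible ⟹ `ρ ≅ Ind_{Γ_L}^{Γ_K} s`" of
  reciprocity along cyclic layers of prime degree (then `Ind` matches automorphic induction).

The index-two case (any field, no twist needed) is
`Summit.Langlands.Langlands.Cruxes.QuadraticImprimitiveSurfaces.Clifford.exists_charpoly_eq_charpoly_comp_indMatrix`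
(Summits side); the abstract lattice-theoretic ingredients are in `CliffordInducedPrimeIndexAbstract`.

## Not here

An explicit conjugacy `Q r Q⁻¹ = Ind(s)` (only characteristic polynomials, hence traces,
determinants and Frobenius data, are matched — enough for Chebotarev–Brauer–Nesbitt arguments);
non-prime index (general Clifford correspondence through the inertia subgroup); positive
characteristic coefficients in the `…_of_prime` / Galois forms (they enter only through
`CliffordTwistDichotomy`).

## References

* A. H. Clifford, *Representations induced in an invariant subgroup*, Ann. of Math. (2) 38
  (1937), 533–550, §§1–3, Thm. 1. [Clifford1937]
* J.-P. Serre, *Linear representations of finite groups*, GTM 42 (1977), §3.3, §7.3 Prop. 22,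
  §8.1 Prop. 24. [SerreLinearRepresentations1977]
-/

noncomputable section

open scoped MatrixGroups

namespace Literature.NumberTheory.GaloisRepresentations

universe u u' v

/-! ### Framed representations: twist-stable of prime index ⟹ induced -/

section Framed

variable {G : Type u} {H : Type u'} [Group G] [TopologicalSpace G] [Group H] [TopologicalSpace H]
  [IsTopologicalGroup H] {A : Type v} [Field A] [TopologicalSpace A] [IsTopologicalRing A] {n : ℕ}

/-- **Clifford's theorem in prime index, twist form ⟹ induced form (characteristic
polynomials).**  Let `r : G →ₜ* GL_n(A)` be an irreducible framed representation over an
algebraically closed topological field `A`, `φ : H →ₜ* G` injective with image `N` of PRIME index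
`p`, and suppose `P r P⁻¹ = r ⊗ χ` for some `P ∈ GL_n(A)` and a continuous character `χ ≠ 1` of
`G` trivial on `N`.  Then `n = p · m` and there is an IRREDUCIBLE framed `s : H →ₜ* GL_m(A)` with
`det(X - r(x)) = det(X - Ind(s)(x))` for every `x ∈ G` and every transversal `t` of `G / N`
(`indMatrix`, flattened by `Matrix.comp`): `V = ⊕_{i<p} r(g₀^i) V_{λ₀}` for an eigenvalue `λ₀` of
`P` and any `g₀` with `χ(g₀) ≠ 1`, and `s` is the frame of the `N`-representation on the
eigenspace `V_{λ₀}`. [cite: Clifford1937, Thm. 1]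
[cite: SerreLinearRepresentations1977, §8.1 Prop. 24, §3.3 Thm. 12 (proof)] -/
theorem FramedRep.exists_charpoly_eq_charpoly_comp_indMatrix_of_conj_eq_twist [IsAlgClosed A]
    (r : FramedRep G A n) (hirr : r.IsIrreducible) (φ : H →ₜ* G) (hinj : Function.Injective φ)
    {p : ℕ} (hp : p.Prime) (hφ : φ.toMonoidHom.range.index = p) (χ : G →ₜ* Aˣ)
    (hχ : ∀ h : H, χ (φ h) = 1) (hχ1 : χ ≠ 1) (P : GL (Fin n) A)
    (hP : FramedRep.conj P r = r.twist χ) :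
    ∃ (m : ℕ) (s : FramedRep H A m), n = p * m ∧ s.IsIrreducible ∧
      ∀ {ι : Type*} [Fintype ι] [DecidableEq ι] (t : ι → G),
        Function.Bijective (fun i => (t i : G ⧸ φ.toMonoidHom.range)) →
        ∀ x : G, FramedRep.charpoly r x =
          (Matrix.comp ι ι (Fin m) (Fin m) A
            (indMatrix φ.toMonoidHom (FramedRep.toMatrixHom s) t x)).charpoly := by
  classical
  haveI : Fact p.Prime := ⟨hp⟩
  set ρ := r.toRepresentation with hρdef
  set N : Subgroup G := φ.toMonoidHom.range with hNdef
  have hinj' : Function.Injective φ.toMonoidHom := hinj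
  have hn : 0 < n := hirr.rank_pos
  haveI : Nonempty (Fin n) := ⟨⟨0, hn⟩⟩
  -- the operator `T = P` and the relation `T (ρ g v) = χ g • ρ g (T v)`
  set T : Module.End A (Fin n → A) := Matrix.toLin' (P : Matrix (Fin n) (Fin n) A) with hTdef
  have hPr : ∀ g : G, (P : Matrix (Fin n) (Fin n) A) * ((r g : GL (Fin n) A) : Matrix _ _ A) =
      (χ g : A) • (((r g : GL (Fin n) A) : Matrix (Fin n) (Fin n) A) * (P : Matrix _ _ A)) :=
    fun g => by
    have h1 := congrArg
      (fun σ : FramedRep G A n => ((σ g : GL (Fin n) A) : Matrix (Fin n) (Fin n) A)) hP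
    simp only [FramedRep.conj_apply, FramedRep.coe_twist_apply, Units.val_mul] at h1
    calc (P : Matrix (Fin n) (Fin n) A) * ((r g : GL (Fin n) A) : Matrix _ _ A)
        = (P : Matrix (Fin n) (Fin n) A) * ((r g : GL (Fin n) A) : Matrix _ _ A) *
            ((P⁻¹ : GL (Fin n) A) : Matrix _ _ A) * (P : Matrix (Fin n) (Fin n) A) := by
          rw [Units.inv_mul_cancel_right]
      _ = (χ g : A) • ((r g : GL (Fin n) A) : Matrix (Fin n) (Fin n) A) * (P : Matrix _ _ A) := by
          rw [h1]
      _ = (χ g : A) • (((r g : GL (Fin n) A) : Matrix (Fin n) (Fin n) A) * (P : Matrix _ _ A)) :=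
          smul_mul_assoc _ _ _
  have hrel : ∀ (g : G) (v : Fin n → A), T (ρ g v) = (χ g : A) • ρ g (T v) := fun g v => by
    rw [hTdef, Matrix.toLin'_apply, Matrix.toLin'_apply, FramedRep.toRepresentation_apply_apply,
      FramedRep.toRepresentation_apply_apply, Matrix.mulVec_mulVec, hPr, Matrix.smul_mulVec,
      Matrix.mulVec_mulVec]
  -- `ρ g` maps the `μ`-eigenspace of `T` into the `χ(g) μ`-eigenspace
  have hmapE : ∀ (g : G) (μ : A), ∀ v ∈ T.eigenspace μ, ρ g v ∈ T.eigenspace ((χ g : A) * μ) := by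
    intro g μ v hv
    rw [Module.End.mem_eigenspace_iff] at hv ⊢
    rw [hrel, hv, map_smul, smul_smul]
  -- `g₀` with `ζ = χ g₀ ≠ 1`; `N ≤ ker χ` has index `p`, `ζ ^ p = 1`, `ζ` of order `p`
  obtain ⟨g₀, hg₀⟩ : ∃ g₀ : G, χ g₀ ≠ 1 := by
    by_contra! hall
    exact hχ1 (ContinuousMonoidHom.ext hall)
  set ζ : Aˣ := χ g₀ with hζdef
  have hNK : N ≤ χ.toMonoidHom.ker := by
    rintro _ ⟨h, rfl⟩
    exact hχ h
  have hKidx : χ.toMonoidHom.ker.index = p := by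
    have hdvd : χ.toMonoidHom.ker.index ∣ p := hφ ▸ Subgroup.index_dvd_of_le hNK
    rcases (Nat.dvd_prime hp).mp hdvd with h1 | h1
    · exfalso
      rw [Subgroup.index_eq_one] at h1
      exact hg₀ (h1 ▸ Subgroup.mem_top g₀ : g₀ ∈ χ.toMonoidHom.ker)
    · exact h1
  have hζp : ζ ^ p = 1 := by
    have h1 : g₀ ^ p ∈ χ.toMonoidHom.ker := hKidx ▸ Subgroup.pow_index_mem _ g₀
    rw [MonoidHom.mem_ker, map_pow] at h1
    exact h1
  have hζord : orderOf ζ = p := orderOf_eq_prime hζp hg₀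
  have hζinj : ∀ i j : Fin p, ζ ^ (i : ℕ) = ζ ^ (j : ℕ) → i = j := fun i j hij => by
    rw [pow_inj_mod, hζord, Nat.mod_eq_of_lt i.2, Nat.mod_eq_of_lt j.2] at hij
    exact Fin.ext hij
  -- the transversal `t₀ i = g₀ ^ i`, `i < p`
  set t₀ : Fin p → G := fun i => g₀ ^ (i : ℕ) with ht₀def
  have hχt₀ : ∀ i : Fin p, χ (t₀ i) = ζ ^ (i : ℕ) := fun i => map_pow χ g₀ i
  haveI : Finite (G ⧸ N) := Nat.finite_of_card_ne_zero (by
    change N.index ≠ 0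
    rw [hφ]
    exact hp.ne_zero)
  have ht₀ : Function.Bijective (fun i => (t₀ i : G ⧸ N)) := by
    have hinjt : Function.Injective (fun i => (t₀ i : G ⧸ N)) := fun i j hij => by
      have h1 : (t₀ i)⁻¹ * t₀ j ∈ χ.toMonoidHom.ker := hNK (QuotientGroup.eq.mp hij)
      rw [MonoidHom.mem_ker, map_mul, map_inv, inv_mul_eq_one] at h1
      exact hζinj i j (by rw [← hχt₀, ← hχt₀]; exact h1)
    refine hinjt.bijective_of_nat_card_le (le_of_eq ?_)
    have h1 : Nat.card (G ⧸ N) = p := hφ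
    rw [Nat.card_fin, h1]
  have hi₀ : t₀ ⟨0, hp.pos⟩ = 1 := pow_zero g₀
  -- an eigenvalue `c₀ ≠ 0` of `T`, the `N`-stable eigenspace `U = V_{c₀}`
  obtain ⟨c₀, hc₀⟩ := Module.End.exists_eigenvalue T
  have hUb' : T.eigenspace c₀ ≠ ⊥ := Module.End.hasEigenvalue_iff.mp hc₀
  have hc₀0 : c₀ ≠ 0 := by
    rintro rfl
    apply hUb'
    rw [Module.End.eigenspace_zero, eq_bot_iff]
    intro v hv
    rw [LinearMap.mem_ker, hTdef, Matrix.toLin'_apply] at hv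
    rw [Submodule.mem_bot, ← Matrix.one_mulVec v, ← Units.inv_mul P, ← Matrix.mulVec_mulVec, hv,
      Matrix.mulVec_zero]
  let W : Subrepresentation (ρ.comp φ.toMonoidHom) :=
    ⟨T.eigenspace c₀, fun h v hv => by
      have h1 := hmapE (φ h) c₀ v hv
      rw [hχ h, Units.val_one, one_mul] at h1
      exact h1⟩
  set U : Submodule A (Fin n → A) := W.toSubmodule with hUdef
  have hUT : U = T.eigenspace c₀ := rfl
  have hWb : W ≠ ⊥ := fun h => hUb' (congrArg Subrepresentation.toSubmodule h)
  have hHU : ∀ (h : H), ∀ v ∈ U, ρ (φ h) v ∈ U := fun h v hv => W.apply_mem_toSubmodule h hv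
  -- the family `F i = ρ(g₀^i) U ≤ E i = V_{ζ^i c₀}`: independent, spanning
  set E : Fin p → Submodule A (Fin n → A) :=
    fun i => T.eigenspace (((ζ ^ (i : ℕ) : Aˣ) : A) * c₀) with hEdef
  set F : Fin p → Submodule A (Fin n → A) := fun i => U.map (ρ (t₀ i)) with hFdef
  have hFE : ∀ i, F i ≤ E i := by
    rintro i _ ⟨v, hv, rfl⟩
    have h1 := hmapE (t₀ i) c₀ v hv
    rwa [hχt₀ i] at h1
  have hE : iSupIndep E := by
    have hμ : Function.Injective fun i : Fin p => ((ζ ^ (i : ℕ) : Aˣ) : A) * c₀ := fun i j hij =>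
      hζinj i j (Units.val_injective (mul_right_cancel₀ hc₀0 hij))
    exact T.eigenspaces_iSupIndep.comp hμ
  have hF : iSupIndep F := hE.mono hFE
  have hF0 : F ⟨0, hp.pos⟩ = U := by
    change U.map (ρ (t₀ ⟨0, hp.pos⟩)) = U
    rw [hi₀, map_one, Module.End.one_eq_id, Submodule.map_id]
  have hFsup : ⨆ i, F i = ⊤ := by
    haveI : _root_.Representation.IsIrreducible ρ := hirr
    let S : Subrepresentation ρ := ⟨⨆ i, F i, fun x v hv =>
      Representation.map_iSup_map_le_of_transversal ρ φ.toMonoidHom ht₀.2 hHU x v hv⟩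
    rcases IsSimpleOrder.eq_bot_or_eq_top S with h | h
    · exfalso
      apply hUb'
      have h' : (⨆ i, F i) = ⊥ := congrArg Subrepresentation.toSubmodule h
      rw [← hUT, ← hF0]
      exact le_bot_iff.mp ((le_iSup F ⟨0, hp.pos⟩).trans h'.le)
    · exact congrArg Subrepresentation.toSubmodule h
  have hint : DirectSum.IsInternal F :=
    DirectSum.isInternal_submodule_of_iSupIndep_of_iSup_eq_top hF hFsup
  -- the `H`-representation on `U`, continuous for the subspace (= module) topology, and its frame
  haveI : IsModuleTopology A U := TwistedSum.isModuleTopology_submodule_pi U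
  let σU : ContinuousRep H A U := ⟨W.toRepresentation, by
    rw [Topology.IsInducing.subtypeVal.continuous_iff]
    change Continuous fun q : H × U =>
      ((r (φ q.1) : GL (Fin n) A) : Matrix (Fin n) (Fin n) A).mulVec (q.2 : Fin n → A)
    exact ((Units.continuous_val.comp ((map_continuous r).comp
      ((map_continuous φ).comp continuous_fst))).matrix_mulVec
      (continuous_subtype_val.comp continuous_snd))⟩
  set m := Module.finrank A U with hmdef
  let bU : Module.Basis (Fin m) A U := Module.finBasis A U
  let s : FramedRep H A m := σU.frame bU
  have hs_coe : ∀ h : H, ((s h : GL (Fin m) A) : Matrix (Fin m) (Fin m) A) =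
      LinearMap.toMatrix bU bU (W.toRepresentation h) := fun h => rfl
  -- the adapted basis `B (i, a) = ρ (t₀ i) (bU a)` of `V = ⊕ᵢ F i`
  let eU : ∀ i : Fin p, U ≃ₗ[A] F i := fun i =>
    Submodule.equivMapOfInjective (ρ (t₀ i))
      (Literature.RepresentationTheory.Semisimple.rep_apply_injective ρ (t₀ i)) U
  let B : Module.Basis (Fin p × Fin m) A (Fin n → A) :=
    (hint.collectedBasis fun i => bU.map (eU i)).reindex (Equiv.sigmaEquivProd (Fin p) (Fin m))
  have hB : ∀ (i : Fin p) (a : Fin m), B (i, a) = ρ (t₀ i) (bU a : Fin n → A) := by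
    intro i a
    simp only [B, eU, Module.Basis.reindex_apply, hint.collectedBasis_coe, Module.Basis.map_apply]
    exact Submodule.coe_equivMapOfInjective_apply _ _ _ _
  refine ⟨m, s, ?_, ?_, ?_⟩
  · -- `n = p m`
    have h := Module.finrank_eq_card_basis B
    rwa [Module.finrank_fin_fun, Fintype.card_prod, Fintype.card_fin, Fintype.card_fin] at h
  · -- `s` is irreducible
    haveI : W.toRepresentation.IsIrreducible :=
      Representation.isIrreducible_toRepresentation_of_iSupIndep ρ hirr φ.toMonoidHom ht₀.2 W hWb
        E hE hFE hi₀ (by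
          change T.eigenspace (((ζ ^ ((⟨0, hp.pos⟩ : Fin p) : ℕ) : Aˣ) : A) * c₀) ≤ T.eigenspace c₀
          rw [pow_zero, Units.val_one, one_mul])
    exact Literature.RepresentationTheory.Semisimple.Representation.isIrreducible_of_equiv
      (σU.frameEquiv bU).toRepEquiv.symm
  · -- characteristic polynomials
    have hcol : ∀ (h : H) (b : Fin m),
        ρ (φ.toMonoidHom h) (bU b : Fin n → A) =
          ∑ c, (FramedRep.toMatrixHom s h) c b • (bU c : Fin n → A) := by
      intro h b
      rw [FramedRep.toMatrixHom_apply, hs_coe]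
      have h1 : W.toRepresentation h (bU b) =
          ∑ c, (LinearMap.toMatrix bU bU (W.toRepresentation h)) c b • bU c := by
        conv_lhs => rw [← Matrix.toLin_toMatrix bU bU (W.toRepresentation h)]
        rw [Matrix.toLin_self]
      have h2 : ρ (φ h) (bU b : Fin n → A) = ((W.toRepresentation h (bU b) : U) : Fin n → A) :=
        rfl
      change ρ (φ h) (bU b : Fin n → A) = _
      rw [h2, h1]
      simp
    intro ι _ _ t ht x
    rw [charpoly_comp_indMatrix_eq_of_transversal hinj' (FramedRep.toMatrixHom s) ht₀ ht x,
      ← Representation.toMatrix_eq_comp_indMatrix ρ hinj' ht₀ (fun a => (bU a : Fin n → A))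
        (FramedRep.toMatrixHom s) hcol B hB x,
      LinearMap.charpoly_toMatrix, FramedRep.charpoly_eq_charpoly_toRepresentation]

/-- **Clifford's theorem in prime index (characteristic polynomials).**  Let `f : H →ₜ* G` be an
open embedding of topological groups with NORMAL image `N` of PRIME index `p`, `A` an
algebraically closed topological field of characteristic zero, and `r : G →ₜ* GL_n(A)` an
irreducible framed representation whose restriction `r ∘ f` is REDUCIBLE.  Then `n = p · m` and
there is an irreducible framed `s : H →ₜ* GL_m(A)` with `det(X - r(x)) = det(X - Ind(s)(x))` for
every `x ∈ G` and every transversal of `G / N`, i.e. `r ≅ Ind_N^G s` at the level of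
characteristic polynomials.  Proof: `G / N` is cyclic of order `p`, so `P r P⁻¹ = r ⊗ χ` for a
character `χ ≠ 1` of `G / N` (`FramedRep.exists_twist_conj_of_not_isIrreducible_comp`), and
`FramedRep.exists_charpoly_eq_charpoly_comp_indMatrix_of_conj_eq_twist` applies.  (Of the two
cases of Serre §8.1 Prop. 24 — `r` induced from a proper subgroup containing `N`, necessarily `N`
itself, or `r|_N` isotypic — the second is excluded for a cyclic quotient and `r|_N` reducible.)
[cite: Clifford1937, Thm. 1] [cite: SerreLinearRepresentations1977, §8.1 Prop. 24] -/
theorem FramedRep.exists_charpoly_eq_charpoly_comp_indMatrix_of_prime [IsTopologicalGroup G]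
    [IsAlgClosed A] [CharZero A] (f : H →ₜ* G) (hf : Topology.IsOpenEmbedding f)
    (hnorm : ∀ (g : G) (h : H), ∃ h' : H, g * f h * g⁻¹ = f h') {p : ℕ} (hp : p.Prime)
    (hφ : f.toMonoidHom.range.index = p) (r : FramedRep G A n) (hirr : r.IsIrreducible)
    (hred : ¬ FramedRep.IsIrreducible (r.comp f)) :
    ∃ (m : ℕ) (s : FramedRep H A m), n = p * m ∧ s.IsIrreducible ∧
      ∀ {ι : Type*} [Fintype ι] [DecidableEq ι] (t : ι → G),
        Function.Bijective (fun i => (t i : G ⧸ f.toMonoidHom.range)) →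
        ∀ x : G, FramedRep.charpoly r x =
          (Matrix.comp ι ι (Fin m) (Fin m) A
            (indMatrix f.toMonoidHom (FramedRep.toMatrixHom s) t x)).charpoly := by
  haveI : Fact p.Prime := ⟨hp⟩
  set N : Subgroup G := f.toMonoidHom.range with hNdef
  haveI hN : N.Normal := ⟨fun x hx g => by
    obtain ⟨h, rfl⟩ := MonoidHom.mem_range.1 hx
    obtain ⟨h', hh'⟩ := hnorm g h
    exact MonoidHom.mem_range.2 ⟨h', hh'.symm⟩⟩
  haveI : IsCyclic (G ⧸ N) := isCyclic_of_prime_card (p := p) hφ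
  haveI : Finite (G ⧸ N) := Nat.finite_of_card_ne_zero (by
    change N.index ≠ 0
    rw [hφ]
    exact hp.ne_zero)
  obtain ⟨χ, P, hχ, hχ1, hP⟩ := FramedRep.exists_twist_conj_of_not_isIrreducible_comp f hf hnorm
    (QuotientGroup.mk' N) (QuotientGroup.mk'_surjective N) (fun g => by
      rw [QuotientGroup.mk'_apply, QuotientGroup.eq_one_iff]
      rfl) r hirr hred
  exact FramedRep.exists_charpoly_eq_charpoly_comp_indMatrix_of_conj_eq_twist r hirr f hf.injective
    hp hφ χ hχ hχ1 P hP

end Framed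

/-! ### Galois representations: Galois layers of prime degree -/

section Galois

open Field

/-- **Clifford's theorem for a Galois extension of number fields of prime degree
(characteristic polynomials).**  Let `L/K` be a Galois extension of number fields of prime degree
`p = [L : K]`, `A` an algebraically closed topological field of characteristic zero, and
`r : Γ_K → GL_n(A)` an IRREDUCIBLE framed Galois representation whose restriction `r|_{Γ_L}`
(`restrictField`, along `absGaloisRestrict K L`) is NOT irreducible.  Then `n = p · m` and there is
an irreducible framed `s : Γ_L → GL_m(A)` with `det(X - r(σ)) = det(X - Ind_{Γ_L}^{Γ_K}(s)(σ))` for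
every `σ ∈ Γ_K` (`FramedGaloisRep.induce`), i.e. `r ≅ Ind_{Γ_L}^{Γ_K} s` at the level of
characteristic polynomials — hence of traces, determinants and Frobenius data.  Proof: `Gal(L/K)`
is cyclic of order `p` (`IsGalois.card_aut_eq_finrank`, `isCyclic_of_prime_card`), so `r` is a
non-trivial twist of itself by a character of `Gal(L/K)`
(`FramedGaloisRep.exists_twist_conj_of_not_isIrreducible_restrictField`), and
`FramedRep.exists_charpoly_eq_charpoly_comp_indMatrix_of_conj_eq_twist` applies with
`[Γ_K : res Γ_L] = [L : K]` (`nat_card_quotient_range_absGaloisRestrict`); the transversal chosen by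
`induce` is immaterial (`FramedGaloisRep.charpoly_induce_eq_charpoly_comp_indMatrix`).
[cite: Clifford1937, Thm. 1] [cite: SerreLinearRepresentations1977, §8.1 Prop. 24, §7.3 Prop. 22] -/
theorem exists_charpoly_eq_charpoly_induce_of_not_isIrreducible_restrictField_of_prime :
    ∀ (K L : Type) [Field K] [NumberField K] [Field L] [NumberField L] [Algebra K L]
      [IsGalois K L], (Module.finrank K L).Prime →
      ∀ {A : Type} [Field A] [TopologicalSpace A] [IsTopologicalRing A] [IsAlgClosed A]
        [CharZero A] {n : ℕ} (r : FramedGaloisRep K A n), FramedRep.IsIrreducible r →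
        ¬ FramedRep.IsIrreducible (r.restrictField L) →
        ∃ (m : ℕ) (s : FramedGaloisRep L A m), n = Module.finrank K L * m ∧
          FramedRep.IsIrreducible s ∧ ∀ σ : Field.absoluteGaloisGroup K,
            FramedRep.charpoly r σ =
              FramedRep.charpoly (s.induce K (rfl : Module.finrank K L = Module.finrank K L)) σ := by
  intro K L _ _ _ _ _ _ hp A _ _ _ _ _ n r hirr hred
  haveI : Fact (Module.finrank K L).Prime := ⟨hp⟩
  haveI : IsCyclic (L ≃ₐ[K] L) :=
    isCyclic_of_prime_card (p := Module.finrank K L) (IsGalois.card_aut_eq_finrank K L)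
  obtain ⟨χ, P, hχ, hχ1, hP⟩ :=
    FramedGaloisRep.exists_twist_conj_of_not_isIrreducible_restrictField (M := L) r hirr hred
  have hidx : (absGaloisRestrict K L).toMonoidHom.range.index = Module.finrank K L :=
    nat_card_quotient_range_absGaloisRestrict K L
  obtain ⟨m, s, hm, hs, hchar⟩ :=
    FramedRep.exists_charpoly_eq_charpoly_comp_indMatrix_of_conj_eq_twist r hirr
      (absGaloisRestrict K L) (absGaloisRestrict_injective K L) hp hidx χ hχ hχ1 P hP
  refine ⟨m, s, hm, hs, fun σ => ?_⟩
  rw [FramedGaloisRep.charpoly_induce_eq_charpoly_comp_indMatrix K rfl s σ]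
  exact hchar (absGaloisCosetRep K L rfl) (absGaloisCosetRep_bijective K L rfl) σ

end Galois

end Literature.NumberTheory.GaloisRepresentations

end
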